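import Summits.AtomisticToContinuum.HydrodynamicLimit.Theorems.LambertianContactSwapSwapGapRelEntBudget
import Summits.AtomisticToContinuum.HydrodynamicLimit.Theorems.LambertianContactSwapSwapGapLiouvilleInvarianceLambda
import Summits.AtomisticToContinuum.HydrodynamicLimit.Theorems.LambertianContactSwapLambertianEulerEntropyBudget
import HarnessLib

/-!
# `SwapGap` (stmt-AtomisticToContinuum-11850), line `Sketch`: the REVERSED entropy decomposition — `KL(q_t ‖ p_t)` is an explicit Loschmidt-echo deficit

Helper file (`--supports stmt-AtomisticToContinuum-11850`) of line `Sketch` (entropy relative to the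
Lambertian law) for the crux `Summit.AtomisticToContinuum.HydrodynamicLimit.Theses.LambertianContactSwap.SwapGap`,
registered stub `stub_reversedDecomposition` (T16) of the lead's skeleton v12, and its corollary
`stub_revRelEntSwap_of_echoMeanReturn` (T18).

Notation: `P_N = localGibbsLaw σ a₀ u₀ θ₀ N Φ` (local Gibbs datum), `G_N = localGibbsLaw σ 1 0 1 N Φ`
(homogeneous Gibbs law, invariant under `Φ` and `Λ`), `p_t = (Φ_t)_* P_N` (deterministic law),
`q_t = (Λ_t)_* (P_N ⊗ γ^ℕ)` (Lambertian law), `L_N = llr P_N G_N` (the log-likelihood of the datum — by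
`llr_localGibbsLaw_ae_eq` an EXPLICIT additive one-particle functional
`∑ᵢ [log a₀(xᵢ) − ‖vᵢ − u₀(xᵢ)‖²/(2θ₀(xᵢ)) − (3/2) log θ₀(xᵢ) + ‖vᵢ‖²/2] + c_N`, i.e. a fixed linear
combination of the profile-tested empirical density / momentum / energy fields).

THE POINT.  The line's forward decomposition (c1, `klDiv_map_flow_map_lambertFlow_decomposition`)
`KL(p_t ‖ q_t) = [KL(P_N ‖ G_N) − KL(q_t ‖ G_N)] + [∫ h_t dq_t − ∫ h_t dp_t]` involves the log-density
`h_t = llr q_t G_N` of the LAMBERTIAN law, an object the tree cannot compute (its evolution is the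
card's contact-flux production identity, untypable without a contact-trace API — PROMOTE.md §Why S1).
In the REVERSED direction the unknown density disappears: the density of `p_t` with respect to `G_N`
is `exp L_N ∘ Φ_{-t}` EXACTLY (Liouville), so (`stub_reversedDecomposition`)

  `KL(q_t ‖ p_t) + [KL(P_N ‖ G_N) − KL(q_t ‖ G_N)] = E_{P_N}[L_N] − E_{P_N ⊗ γ^ℕ}[L_N(Φ_{-t}(Λ_t(z, ξ)))]`,

both brackets on the left being `≥ 0` (the second by data processing along `Λ`).  The right-hand side
is the ECHO DEFICIT of ONE explicit macroscopic observable: run the Lambertian gas forward for time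
`t`, the deterministic gas backward for time `t`, and compare the mean of `L_N` with its initial mean
— no Jensen step, no unknown density (contrast the forward echo form `KL(p_t ‖ q_t) = KL(P_N ‖ (Φ_{-t})_* q_t)`,
whose evaluation needs the law of the echo, and whose "echo-LLN via Jensen" bound is lossy by `Θ(N)`,
crux NOTES c2).  Consequences: `KL(q_t ‖ p_t) ≤ (N+1)·deficit_N(t)` and
`KL(P_N ‖ G_N) − KL(q_t ‖ G_N) ≤ (N+1)·deficit_N(t)`, so the single explicit statement
ECHO MEAN RETURN `deficit_N(t) → 0` (pre-shock) gives BOTH the reversed entropy swap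
`KL(q_t ‖ p_t) = o(N)` (`stub_revRelEntSwap_of_echoMeanReturn`) AND the `Λ`-adiabaticity `a_N → 0` of the
forward line; with speed-`N` concentration of the DETERMINISTIC gas's field statistics it closes the
crux by the transfer run from `q_t` to `p_t` (skeleton v12 §12, `swapGap_of_stubs_reversed`).

Proof: transport both arguments of `KL(q_t ‖ p_t)` by the measurable a.e.-inverse `Φ_{-t}`
(`klDiv_map_eq_of_leftInvOn` on the good set, which carries `q_t` — dominated by an energy tilt of
`G_N`, c1 — and `p_t`): `KL(q_t ‖ p_t) = KL(r_t ‖ P_N)`, `r_t = (Φ_{-t})_* q_t` the echo law; then the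
two-sidedly dominated chain rule (`toReal_klDiv_eq_of_dominated`, c1) against the STATIC domination
`G_N e^{-V} ≤ P_N ≤ G_N e^{V}`, `V = A(N+1) + bE` (`exists_localGibbsLaw_dominated`):
`KL(r_t ‖ P_N) = KL(r_t ‖ G_N) − ∫ L_N dr_t`, with `KL(r_t ‖ G_N) = KL(q_t ‖ G_N)` (`G_N` is
`Φ`-invariant) and `∫ L_N dr_t = E[L_N(Φ_{-t} Λ_t)]`; finally `KL(P_N ‖ G_N) = ∫ L_N dP_N`.
The `Λ`-invariance of `liouville ⊗ γ^ℕ` is the landed `stub_liouvilleInvarianceLambda` (p116909).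

prover-line-stmt-AtomisticToContinuum-11850-c6-0 (lead c6), cycle 7.
-/

noncomputable section

open MeasureTheory Filter Set Topology InformationTheory
open scoped ENNReal

namespace Summit.AtomisticToContinuum.HydrodynamicLimit.Theorems

open Literature.Analysis.FluidPDE Literature.MathematicalPhysics.KineticTheory
open Summit.AtomisticToContinuum.HydrodynamicLimit.Theorems.LambertianContactSwapSwapGapRelEntBudget
open Summit.AtomisticToContinuum.HydrodynamicLimit.Theorems.LambertianContactSwapLambertianEulerGibbsInvariance
open Summit.AtomisticToContinuum.HydrodynamicLimit.Theorems.LambertianContactSwapSwapGapGibbsDomination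
open Summit.AtomisticToContinuum.HydrodynamicLimit.Theorems.LambertianContactSwapSwapGapDominatedKL
open Summit.AtomisticToContinuum.HydrodynamicLimit.Theorems.LambertianContactSwapLambertianEulerEntropyBudget

/-- **T16 · THE REVERSED DECOMPOSITION** (`stub_reversedDecomposition`, registered stub of line `Sketch`, skeleton
v12 §12): for continuous profiles `a₀, θ₀ > 0`, `u₀`, `0 < σ < 1/2`, every `N`, every hard-sphere flow `Φ` and
every `t ≥ 0`, with `P_N`, `G_N`, `p_t`, `q_t`, `L_N = llr P_N G_N` as in the module docstring:
`KL(q_t ‖ p_t) < ∞`, `KL(P_N ‖ G_N) < ∞`, `KL(q_t ‖ G_N) ≤ KL(P_N ‖ G_N)` (data processing along `Λ`),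
`L_N` is `P_N`-integrable, the echo observable `L_N ∘ Φ_{-t} ∘ Λ_t` is `P_N ⊗ γ^ℕ`-integrable, and
`KL(q_t ‖ p_t) + [KL(P_N ‖ G_N) − KL(q_t ‖ G_N)] = ∫ L_N dP_N − ∫ L_N(Φ_{-t}(Λ_t p)) d(P_N ⊗ γ^ℕ)(p)`.
[cite: KipnisLandim1999, Ch. 6 §1] -/
theorem stub_reversedDecomposition
    {a₀ θ₀ : T3 → ℝ} {u₀ : T3 → V3} (ha : Continuous a₀) (hθ : Continuous θ₀)
    (hu : Continuous u₀) (ha0 : ∀ x, 0 < a₀ x) (hθ0 : ∀ x, 0 < θ₀ x) {σ : ℝ} (hσ : 0 < σ)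
    (hσ' : σ < 2⁻¹) (N : ℕ) (Φ : HardSphereFlow (Torus.geometry (Fin 3)) (hsDiameter σ N) (N + 1))
    {t : ℝ} (ht : 0 ≤ t) :
    klDiv (((localGibbsLaw σ a₀ u₀ θ₀ N Φ).prod (lambertNoise (Fin 3))).map
          (fun p => lambertFlow (Torus.geometry (Fin 3)) (hsDiameter σ N) p.2 p.1 t))
        ((localGibbsLaw σ a₀ u₀ θ₀ N Φ).map (Φ.flow t)) ≠ ∞ ∧
    klDiv (localGibbsLaw σ a₀ u₀ θ₀ N Φ)
        (localGibbsLaw σ (fun _ => 1) (fun _ => 0) (fun _ => 1) N Φ) ≠ ∞ ∧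
    klDiv (((localGibbsLaw σ a₀ u₀ θ₀ N Φ).prod (lambertNoise (Fin 3))).map
          (fun p => lambertFlow (Torus.geometry (Fin 3)) (hsDiameter σ N) p.2 p.1 t))
        (localGibbsLaw σ (fun _ => 1) (fun _ => 0) (fun _ => 1) N Φ) ≤
      klDiv (localGibbsLaw σ a₀ u₀ θ₀ N Φ)
        (localGibbsLaw σ (fun _ => 1) (fun _ => 0) (fun _ => 1) N Φ) ∧
    Integrable (llr (localGibbsLaw σ a₀ u₀ θ₀ N Φ)
        (localGibbsLaw σ (fun _ => 1) (fun _ => 0) (fun _ => 1) N Φ)) (localGibbsLaw σ a₀ u₀ θ₀ N Φ) ∧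
    Integrable (fun p => llr (localGibbsLaw σ a₀ u₀ θ₀ N Φ)
        (localGibbsLaw σ (fun _ => 1) (fun _ => 0) (fun _ => 1) N Φ)
        (Φ.flow (-t) (lambertFlow (Torus.geometry (Fin 3)) (hsDiameter σ N) p.2 p.1 t)))
      ((localGibbsLaw σ a₀ u₀ θ₀ N Φ).prod (lambertNoise (Fin 3))) ∧
    (klDiv (((localGibbsLaw σ a₀ u₀ θ₀ N Φ).prod (lambertNoise (Fin 3))).map
          (fun p => lambertFlow (Torus.geometry (Fin 3)) (hsDiameter σ N) p.2 p.1 t))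
        ((localGibbsLaw σ a₀ u₀ θ₀ N Φ).map (Φ.flow t))).toReal +
      ((klDiv (localGibbsLaw σ a₀ u₀ θ₀ N Φ)
          (localGibbsLaw σ (fun _ => 1) (fun _ => 0) (fun _ => 1) N Φ)).toReal -
        (klDiv (((localGibbsLaw σ a₀ u₀ θ₀ N Φ).prod (lambertNoise (Fin 3))).map
            (fun p => lambertFlow (Torus.geometry (Fin 3)) (hsDiameter σ N) p.2 p.1 t))
          (localGibbsLaw σ (fun _ => 1) (fun _ => 0) (fun _ => 1) N Φ)).toReal) =
      (∫ z, llr (localGibbsLaw σ a₀ u₀ θ₀ N Φ)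
          (localGibbsLaw σ (fun _ => 1) (fun _ => 0) (fun _ => 1) N Φ) z ∂(localGibbsLaw σ a₀ u₀ θ₀ N Φ)) -
        ∫ p, llr (localGibbsLaw σ a₀ u₀ θ₀ N Φ)
          (localGibbsLaw σ (fun _ => 1) (fun _ => 0) (fun _ => 1) N Φ)
          (Φ.flow (-t) (lambertFlow (Torus.geometry (Fin 3)) (hsDiameter σ N) p.2 p.1 t))
          ∂((localGibbsLaw σ a₀ u₀ θ₀ N Φ).prod (lambertNoise (Fin 3))) := by
  have hσ2 : σ ≤ 1 / 2 := by rw [one_div]; exact hσ'.le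
  have hLI : ∀ ε : ℝ, 0 < ε → ε < 2⁻¹ → ∀ (N : ℕ) (t : ℝ), 0 ≤ t →
      ((liouville (Torus.geometry (Fin 3)) N ε).prod (lambertNoise (Fin 3))).map
          (fun p => lambertFlow (Torus.geometry (Fin 3)) ε p.2 p.1 t) =
        liouville (Torus.geometry (Fin 3)) N ε :=
    LambertianContactSwapSwapGapLiouvilleInvarianceLambda.stub_liouvilleInvarianceLambda
  obtain ⟨A, b, hA, hb, hdom⟩ := exists_localGibbsLaw_dominated ha hθ hu ha0 hθ0 hσ2
  obtain ⟨h1, h2, h3, hEi, -⟩ := hdom N Φ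
  set P := localGibbsLaw σ a₀ u₀ θ₀ N Φ with hPdef
  set Gr := localGibbsLaw σ (fun _ => (1 : ℝ)) (fun _ => (0 : V3)) (fun _ => (1 : ℝ)) N Φ with hGdef
  set Λt : Config (N + 1) (Fin 3) T3 × (ℕ → V3) → Config (N + 1) (Fin 3) T3 :=
    fun p => lambertFlow (Torus.geometry (Fin 3)) (hsDiameter σ N) p.2 p.1 t with hΛt
  have hΛ : Measurable Λt := measurable_lambertFlow_hsDiameter hσ.le hσ' N t
  haveI : IsProbabilityMeasure P := isProbabilityMeasure_localGibbsLaw ha hθ hu ha0 hθ0 hσ2 N Φ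
  haveI : IsProbabilityMeasure Gr := isProbabilityMeasure_localGibbsLaw (a₀ := fun _ => (1 : ℝ))
    (θ₀ := fun _ => (1 : ℝ)) (u₀ := fun _ => (0 : V3)) continuous_const continuous_const
    continuous_const (fun _ => one_pos) (fun _ => one_pos) hσ2 N Φ
  haveI : StandardBorelSpace (Config (N + 1) (Fin 3) T3) := standardBorelSpace_config (N + 1)
  set μ := P.map (Φ.flow t) with hμ
  set ν := (P.prod (lambertNoise (Fin 3))).map Λt with hν
  set r := ν.map (Φ.flow (-t)) with hr
  haveI : IsProbabilityMeasure μ :=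
    Measure.isProbabilityMeasure_map (Φ.measurable_flow t).aemeasurable
  haveI : IsProbabilityMeasure ν := Measure.isProbabilityMeasure_map hΛ.aemeasurable
  haveI : IsProbabilityMeasure r :=
    Measure.isProbabilityMeasure_map (Φ.measurable_flow (-t)).aemeasurable
  -- invariances of the homogeneous Gibbs law
  have hGinv : ∀ s : ℝ, Gr.map (Φ.flow s) = Gr := fun s =>
    map_flow_localGibbsLaw_const σ 1 1 0 N Φ s
  have hGΛ : (Gr.prod (lambertNoise (Fin 3))).map Λt = Gr :=
    gibbsInvariance_of_liouvilleInvariance hLI hσ hσ' N 1 1 0 Φ ht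
  -- the tilt `V = A(N+1) + b E`
  set V : Config (N + 1) (Fin 3) T3 → ℝ := fun z => A * ((N : ℝ) + 1) + b * configEnergy z with hV
  have hEm : Measurable (configEnergy : Config (N + 1) (Fin 3) T3 → ℝ) := by
    unfold configEnergy
    exact measurable_const.mul
      (Finset.measurable_sum _ fun i _ => ((measurable_pi_apply i).snd).norm.pow_const 2)
  have hVm : Measurable V := (measurable_const.mul hEm).const_add _
  -- laws carried by the good set
  have hPL : P ≪ liouville (Torus.geometry (Fin 3)) (N + 1) (hsDiameter σ N) :=
    withDensity_absolutelyContinuous _ _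
  have hGL : Gr ≪ liouville (Torus.geometry (Fin 3)) (N + 1) (hsDiameter σ N) :=
    withDensity_absolutelyContinuous _ _
  have hPgood : P Φ.goodᶜ = 0 := measure_compl_good_eq_zero_of_absolutelyContinuous Φ hPL
  have hGgood : Gr Φ.goodᶜ = 0 := measure_compl_good_eq_zero_of_absolutelyContinuous Φ hGL
  -- the Lambertian law is two-sidedly dominated (static domination transported along `Λ`)
  obtain ⟨hlow, hup⟩ := withDensity_le_map_prod_lambertFlow_le_withDensity hLI hσ hσ' N Φ ht
    (P := P) (F₁ := fun e => ENNReal.ofReal (Real.exp (-(A * ((N : ℝ) + 1) + b * e))))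
    (F₂ := fun e => ENNReal.ofReal (Real.exp (A * ((N : ℝ) + 1) + b * e)))
    ((Real.measurable_exp.comp ((measurable_const.mul measurable_id).const_add _).neg).ennreal_ofReal)
    ((Real.measurable_exp.comp ((measurable_const.mul measurable_id).const_add _)).ennreal_ofReal)
    h2 h1
  have hνG : ν ≪ Gr :=
    (Measure.absolutelyContinuous_of_le hup).trans (withDensity_absolutelyContinuous _ _)
  have hνgood : ν Φ.goodᶜ = 0 := measure_compl_good_eq_zero_of_absolutelyContinuous Φ (hνG.trans hGL)
  -- `KL(q_t ‖ G)` is finite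
  obtain ⟨-, hbdν, -⟩ := llr_ae_of_dominated (μ := ν) hνG hVm hlow hup
  have hEΛ : ∀ᵐ p ∂(P.prod (lambertNoise (Fin 3))), configEnergy (Λt p) = configEnergy p.1 := by
    refine (Measure.ae_prod_iff_ae_ae ?_).2 (ae_of_all _ fun z =>
      (ae_lambertNoise_forall_configEnergy_lambertFlow_hsDiameter hσ.le hσ' N z).mono
        fun ξs h => h t)
    exact measurableSet_eq_fun (hEm.comp hΛ) (hEm.comp measurable_fst)
  have hEiν : Integrable (configEnergy : Config (N + 1) (Fin 3) T3 → ℝ) ν := by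
    rw [hν, integrable_map_measure hEm.aestronglyMeasurable hΛ.aemeasurable]
    exact (hEi.comp_fst (lambertNoise (Fin 3))).congr (hEΛ.mono fun p hp => hp.symm)
  have hViν : Integrable V ν := (integrable_const _).add (hEiν.const_mul b)
  have hiν : Integrable (llr ν Gr) ν := by
    refine Integrable.mono' hViν (measurable_llr _ _).aestronglyMeasurable ?_
    filter_upwards [hbdν] with x hx
    rw [Real.norm_eq_abs]
    exact abs_le.2 hx
  have hfinνG : klDiv ν Gr ≠ ∞ := klDiv_ne_top hνG hiν
  -- transport of both arguments of a relative entropy by `Φ_{-t}` (a.e. inverse `Φ_t` on the good set)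
  have key : ∀ (a c : Measure (Config (N + 1) (Fin 3) T3)) [IsFiniteMeasure a] [IsFiniteMeasure c],
      a Φ.goodᶜ = 0 → c Φ.goodᶜ = 0 →
        klDiv (a.map (Φ.flow (-t))) (c.map (Φ.flow (-t))) = klDiv a c :=
    fun a c _ _ hag hcg =>
      Literature.MathematicalPhysics.StatisticalMechanics.klDiv_map_eq_of_leftInvOn
        (Φ.measurable_flow (-t)) (Φ.measurable_flow t) Φ.measurableSet_good hag hcg
        (fun z hz => Φ.flow_flow_neg t hz)
  have hgoodP : ∀ᵐ z ∂P, z ∈ Φ.good := by rw [ae_iff]; exact hPgood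
  have hμback : μ.map (Φ.flow (-t)) = P := by
    rw [hμ, Measure.map_map (Φ.measurable_flow (-t)) (Φ.measurable_flow t),
      Measure.map_congr (show (Φ.flow (-t) ∘ Φ.flow t) =ᵐ[P] id from
        hgoodP.mono fun z hz => Φ.flow_neg_flow t hz), Measure.map_id]
  have hμgood : μ Φ.goodᶜ = 0 := by
    rw [hμ, Measure.map_apply (Φ.measurable_flow t) Φ.measurableSet_good.compl]
    refine measure_mono_null (fun z hz => ?_) hPgood
    intro hzg
    exact hz (Φ.mapsTo_good t hzg)
  have hklνμ : klDiv ν μ = klDiv r P := by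
    rw [← key ν μ hνgood hμgood, hμback]
  have hklrG : klDiv r Gr = klDiv ν Gr := by
    have h := key ν Gr hνgood hGgood
    rwa [hGinv (-t)] at h
  have hrG : r ≪ Gr := by
    have h := hνG.map (Φ.measurable_flow (-t))
    rwa [hGinv (-t)] at h
  have hfinrG : klDiv r Gr ≠ ∞ := by rw [hklrG]; exact hfinνG
  -- `V` is `r`-integrable (energy conserved along `Φ`)
  have hgoodν : ∀ᵐ z ∂ν, z ∈ Φ.good := by rw [ae_iff]; exact hνgood
  have hEr : Integrable (configEnergy : Config (N + 1) (Fin 3) T3 → ℝ) r := by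
    rw [hr, integrable_map_measure hEm.aestronglyMeasurable (Φ.measurable_flow (-t)).aemeasurable]
    exact hEiν.congr (hgoodν.mono fun z hz => (Φ.configEnergy_flow hz (-t)).symm)
  have hVr : Integrable V r := (integrable_const _).add (hEr.const_mul b)
  -- the dominated chain rule for `KL(r_t ‖ P_N)` against the STATIC domination of `P_N`
  obtain ⟨hfinrP, hirP, heqr, -⟩ := toReal_klDiv_eq_of_dominated hrG hfinrG hVm hVr hVr h2 h1
  -- `KL(P_N ‖ G_N) = ∫ L_N dP_N`
  have hPG : P ≪ Gr := (Measure.absolutelyContinuous_of_le h1).trans (withDensity_absolutelyContinuous _ _)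
  obtain ⟨-, hbdP, -⟩ := llr_ae_of_dominated (μ := P) hPG hVm h2 h1
  have hViP : Integrable V P := (integrable_const _).add (hEi.const_mul b)
  have hiP : Integrable (llr P Gr) P := by
    refine Integrable.mono' hViP (measurable_llr _ _).aestronglyMeasurable ?_
    filter_upwards [hbdP] with x hx
    rw [Real.norm_eq_abs]
    exact abs_le.2 hx
  have hklP : (klDiv P Gr).toReal = ∫ z, llr P Gr z ∂P := toReal_klDiv_of_measure_eq hPG (by simp)
  -- the echo integral
  have hmeas : AEStronglyMeasurable (fun z => llr P Gr (Φ.flow (-t) z))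
      ((P.prod (lambertNoise (Fin 3))).map Λt) :=
    ((measurable_llr _ _).comp (Φ.measurable_flow (-t))).aestronglyMeasurable
  have hintr : ∫ x, llr P Gr x ∂r = ∫ p, llr P Gr (Φ.flow (-t) (Λt p)) ∂(P.prod (lambertNoise (Fin 3))) := by
    rw [hr, integral_map (Φ.measurable_flow (-t)).aemeasurable (measurable_llr _ _).aestronglyMeasurable,
      hν, integral_map hΛ.aemeasurable hmeas]
  have hiecho : Integrable (fun p => llr P Gr (Φ.flow (-t) (Λt p))) (P.prod (lambertNoise (Fin 3))) := by
    have h := hirP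
    rw [hr, integrable_map_measure (measurable_llr _ _).aestronglyMeasurable
      (Φ.measurable_flow (-t)).aemeasurable] at h
    have h2 : Integrable (fun z => llr P Gr (Φ.flow (-t) z)) ((P.prod (lambertNoise (Fin 3))).map Λt) := h
    rw [integrable_map_measure hmeas hΛ.aemeasurable] at h2
    exact h2
  refine ⟨?_, ne_top_of_le_ne_top ENNReal.ofReal_ne_top h3, ?_, hiP, hiecho, ?_⟩
  · rw [hklνμ]; exact hfinrP
  · exact klDiv_map_prod_le_of_invariant P Gr (lambertNoise (Fin 3)) hΛ hGΛ
  · rw [hklνμ, heqr, hklrG, hklP, hintr]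
    ring

/-- **T18 · ECHO MEAN RETURN ⟹ REVERSED ENTROPY SWAP** (`stub_revRelEntSwap_of_echoMeanReturn`, registered stub of line
`Sketch`, skeleton v12 §12): with the crux's quantifier prefix, if the Loschmidt-echo deficit of the log-likelihood
observable `L_N = llr P_N G_N` is `o(N)` pre-shock (ECHO MEAN RETURN, the research stub S1ʳ′ `stub_echoMeanReturn`), then
`KL(q_t ‖ p_t)/(N+1) → 0` in `ℝ≥0∞` pre-shock (S1ʳ, `RevRelEntSwap`) — because
`KL(q_t ‖ p_t) ≤ KL(q_t ‖ p_t) + [KL(P_N ‖ G_N) − KL(q_t ‖ G_N)] = (N+1)·deficit_N(t)` (`stub_reversedDecomposition`).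
Threshold `σ₀ := min (1/2) σ_E`. [cite: KipnisLandim1999, Ch. 6 §1] -/
theorem stub_revRelEntSwap_of_echoMeanReturn
    (hE : ∀ (a₀ θ₀ : T3 → ℝ) (u₀ : T3 → V3), Continuous a₀ → Continuous θ₀ → Continuous u₀ →
      (∀ x, 0 < a₀ x) → (∀ x, 0 < θ₀ x) →
      ∃ σ₀ : ℝ, 0 < σ₀ ∧ ∀ σ : ℝ, 0 < σ → σ < σ₀ →
        ∀ (T : ℝ) (ρ θ : ℝ → T3 → ℝ) (u : ℝ → T3 → V3), IsHardSphereEulerSolution σ T ρ u θ →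
          ∀ Φ : (N : ℕ) → HardSphereFlow (Torus.geometry (Fin 3)) (hsDiameter σ N) (N + 1),
            TendstoHydroFieldsAt (fun N => localGibbsLaw σ a₀ u₀ θ₀ N (Φ N)) Φ ρ u θ 0 →
              ∀ t ∈ Set.Ico 0 T,
                Tendsto (fun N : ℕ =>
                  ((∫ z, llr (localGibbsLaw σ a₀ u₀ θ₀ N (Φ N))
                      (localGibbsLaw σ (fun _ => 1) (fun _ => 0) (fun _ => 1) N (Φ N)) z
                      ∂(localGibbsLaw σ a₀ u₀ θ₀ N (Φ N))) -
                    ∫ p, llr (localGibbsLaw σ a₀ u₀ θ₀ N (Φ N))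
                      (localGibbsLaw σ (fun _ => 1) (fun _ => 0) (fun _ => 1) N (Φ N))
                      ((Φ N).flow (-t) (lambertFlow (Torus.geometry (Fin 3)) (hsDiameter σ N) p.2 p.1 t))
                      ∂((localGibbsLaw σ a₀ u₀ θ₀ N (Φ N)).prod (lambertNoise (Fin 3)))) /
                    ((N : ℝ) + 1)) atTop (𝓝 0)) :
    ∀ (a₀ θ₀ : T3 → ℝ) (u₀ : T3 → V3), Continuous a₀ → Continuous θ₀ → Continuous u₀ →
      (∀ x, 0 < a₀ x) → (∀ x, 0 < θ₀ x) →
      ∃ σ₀ : ℝ, 0 < σ₀ ∧ ∀ σ : ℝ, 0 < σ → σ < σ₀ →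
        ∀ (T : ℝ) (ρ θ : ℝ → T3 → ℝ) (u : ℝ → T3 → V3), IsHardSphereEulerSolution σ T ρ u θ →
          ∀ Φ : (N : ℕ) → HardSphereFlow (Torus.geometry (Fin 3)) (hsDiameter σ N) (N + 1),
            TendstoHydroFieldsAt (fun N => localGibbsLaw σ a₀ u₀ θ₀ N (Φ N)) Φ ρ u θ 0 →
              ∀ t ∈ Set.Ico 0 T,
                Tendsto (fun N : ℕ =>
                  klDiv (((localGibbsLaw σ a₀ u₀ θ₀ N (Φ N)).prod (lambertNoise (Fin 3))).map
                      (fun p => lambertFlow (Torus.geometry (Fin 3)) (hsDiameter σ N) p.2 p.1 t))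
                    ((localGibbsLaw σ a₀ u₀ θ₀ N (Φ N)).map ((Φ N).flow t)) /
                  ((N : ℝ≥0∞) + 1)) atTop (𝓝 0) := by
  intro a₀ θ₀ u₀ ha hθ hu ha0 hθ0
  obtain ⟨σE, hσE, hE'⟩ := hE a₀ θ₀ u₀ ha hθ hu ha0 hθ0
  refine ⟨min 2⁻¹ σE, lt_min (by norm_num) hσE, ?_⟩
  intro σ hσ hσlt T ρ θ u hEul Φ h0 t ht
  have hσhalf : σ < 2⁻¹ := hσlt.trans_le (min_le_left _ _)
  have hσE' : σ < σE := hσlt.trans_le (min_le_right _ _)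
  have hD := hE' σ hσ hσE' T ρ θ u hEul Φ h0 t ht
  -- names
  set k : ℕ → ℝ≥0∞ := fun N =>
    klDiv (((localGibbsLaw σ a₀ u₀ θ₀ N (Φ N)).prod (lambertNoise (Fin 3))).map
        (fun p => lambertFlow (Torus.geometry (Fin 3)) (hsDiameter σ N) p.2 p.1 t))
      ((localGibbsLaw σ a₀ u₀ θ₀ N (Φ N)).map ((Φ N).flow t)) with hk
  set D : ℕ → ℝ := fun N =>
    (∫ z, llr (localGibbsLaw σ a₀ u₀ θ₀ N (Φ N))
        (localGibbsLaw σ (fun _ => 1) (fun _ => 0) (fun _ => 1) N (Φ N)) z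
        ∂(localGibbsLaw σ a₀ u₀ θ₀ N (Φ N))) -
      ∫ p, llr (localGibbsLaw σ a₀ u₀ θ₀ N (Φ N))
        (localGibbsLaw σ (fun _ => 1) (fun _ => 0) (fun _ => 1) N (Φ N))
        ((Φ N).flow (-t) (lambertFlow (Torus.geometry (Fin 3)) (hsDiameter σ N) p.2 p.1 t))
        ∂((localGibbsLaw σ a₀ u₀ θ₀ N (Φ N)).prod (lambertNoise (Fin 3))) with hDdef
  -- per `N`: `k_N` finite and `k_N.toReal ≤ D_N`
  have hle : ∀ N, k N ≠ ∞ ∧ (k N).toReal ≤ D N := by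
    intro N
    obtain ⟨hfin, hfinP, hdp, -, -, heq⟩ :=
      stub_reversedDecomposition ha hθ hu ha0 hθ0 hσ hσhalf N (Φ N) ht.1
    refine ⟨hfin, ?_⟩
    have hbr : 0 ≤ (klDiv (localGibbsLaw σ a₀ u₀ θ₀ N (Φ N))
          (localGibbsLaw σ (fun _ => 1) (fun _ => 0) (fun _ => 1) N (Φ N))).toReal -
        (klDiv (((localGibbsLaw σ a₀ u₀ θ₀ N (Φ N)).prod (lambertNoise (Fin 3))).map
            (fun p => lambertFlow (Torus.geometry (Fin 3)) (hsDiameter σ N) p.2 p.1 t))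
          (localGibbsLaw σ (fun _ => 1) (fun _ => 0) (fun _ => 1) N (Φ N))).toReal :=
      sub_nonneg.2 (ENNReal.toReal_mono hfinP hdp)
    have h := heq
    change (k N).toReal + _ = D N at h
    linarith
  -- squeeze in `ℝ≥0∞`
  have hcast : ∀ N : ℕ, ENNReal.ofReal ((N : ℝ) + 1) = (N : ℝ≥0∞) + 1 := fun N => by
    rw [ENNReal.ofReal_add (by positivity) zero_le_one, ENNReal.ofReal_natCast, ENNReal.ofReal_one]
  have hbound : ∀ N : ℕ, k N / ((N : ℝ≥0∞) + 1) ≤ ENNReal.ofReal (D N / ((N : ℝ) + 1)) := by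
    intro N
    obtain ⟨hfin, hleN⟩ := hle N
    rw [ENNReal.ofReal_div_of_pos (by positivity), hcast N]
    gcongr
    rw [← ENNReal.ofReal_toReal hfin]
    exact ENNReal.ofReal_le_ofReal hleN
  have hlim : Tendsto (fun N : ℕ => ENNReal.ofReal (D N / ((N : ℝ) + 1))) atTop (𝓝 0) := by
    rw [← ENNReal.ofReal_zero]
    exact ENNReal.tendsto_ofReal hD
  exact tendsto_of_tendsto_of_tendsto_of_le_of_le tendsto_const_nhds hlim (fun N => zero_le) hbound

end Summit.AtomisticToContinuum.HydrodynamicLimit.Theorems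

end
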